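import Literature.Analysis.FluidPDE.SereginSverak2002WithFinalEnergy
import Literature.Analysis.FluidPDE.AxisymmetricEuler
import HarnessLib

/-!
# The Seregin–Šverák pressure alternative for every witness of the crux `CertifiedBlowupAxisymBlowup`

Theorems file landed `--supports stmt-NavierStokesRegularity-0727`, line `compact-amplification`
(wave c4, registered stub `pressure_alternative_of_isMaximalSmoothSolution`). A witness of the crux
is a viscosity `ν > 0`, a time `T > 0` and a maximal smooth solution `(u, p)` of the unforced
Navier–Stokes system of lifespan `T` (`IsMaximalSmoothSolution ν 0 u p T`: classical on `[0, T)`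
and NOT smoothly extendable past `T`), Leray–Hopf on `[0, T]` from its rapidly decaying
axisymmetric datum `u 0`.

Seregin–Šverák 2002, Thm. 2.2 (p. 70), in the corrected tree form
`seregin_sverak_2002_withFinalEnergy` (discharged, `seregin_sverak_2002_withFinalEnergy_holds`):
if EITHER the head pressure `|u|²/2 + p̃` is bounded above OR the normalised pressure `p̃` is
bounded below on `(0, T) × ℝ³`, and the final value `u T` has no scaled `L²` concentration
(`r⁻¹ ∫_{B(x₀,r)} ‖u(T)‖² → 0` as `r → 0⁺` at every `x₀`), then `u` is bounded near `T` and
hence (`seregin_sverak_2002_withFinalEnergy.hasSmoothExtensionPast`, via RRS 2016 Thm. 8.17,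
`hasSmoothExtensionPast_of_bounded_holds`) extends smoothly past `T`. At the crux, by maximality:
UNLESS the final slice concentrates at the scale-critical `L²` rate somewhere, the normalised
pressure of a witness is UNBOUNDED BELOW and its head pressure is UNBOUNDED ABOVE on
`(0, T) × ℝ³` — the classical pressure diagnostic every certified blow-up candidate must exhibit.

No new definitions, no named-fact hypotheses, no `sorry`.

## References

* G. Seregin, V. Šverák, *Navier–Stokes equations with lower bounds on the pressure*,
  Arch. Ration. Mech. Anal. 163 (2002) 65–86, Thm. 2.2 (p. 70). [SereginSverak2002]
* J. C. Robinson, J. L. Rodrigo, W. Sadowski, *The Three-Dimensional Navier–Stokes Equations*,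
  CUP 2016, Thm. 8.17. [RobinsonRodrigoSadowski2016]
-/

-- the summit and its single problem share the name (D-0017 nested layout)
set_option linter.dupNamespace false

noncomputable section

open MeasureTheory Set Function Filter Topology Metric
open scoped ENNReal NNReal

namespace Summit.NavierStokesRegularity.NavierStokesRegularity.Theorems.CertifiedBlowupAxisymBlowup.CompactAmplification

open Literature.Analysis Literature.Analysis.FluidPDE

/-- **Seregin–Šverák pressure alternative at the crux** (registered stub of
stmt-NavierStokesRegularity-0727; Seregin–Šverák 2002, Thm. 2.2 with the final-time hypothesis
explicit): for every maximal Leray–Hopf classical solution `(u, p)` of viscosity `ν > 0` and finite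
lifespan `T > 0` from a rapidly decaying axisymmetric datum whose final value `u T` has no scaled
`L²` energy concentration (`r⁻¹ ∫_{B(x₀,r)} ‖u T‖² → 0` as `r → 0⁺`, every `x₀`), the normalised
pressure `p̃[u t]` is unbounded below on `(0, T) × ℝ³` AND the head pressure `‖u t x‖²/2 + p̃[u t] x`
is unbounded above there. Proof: either one-sided bound would, by
`seregin_sverak_2002_withFinalEnergy.hasSmoothExtensionPast` (the discharged fact
`seregin_sverak_2002_withFinalEnergy_holds` continued by `hasSmoothExtensionPast_of_bounded_holds`),
extend `u` smoothly past `T`, contradicting maximality. (Axisymmetry is not used.)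
[cite: SereginSverak2002, Thm. 2.2 (p. 70)] -/
theorem pressure_alternative_of_isMaximalSmoothSolution : ∀ {ν T : ℝ} {u : ℝ → EuclideanSpace ℝ (Fin 3) → EuclideanSpace ℝ (Fin 3)} {p : ℝ → EuclideanSpace ℝ (Fin 3) → ℝ}, 0 < ν → 0 < T → IsMaximalSmoothSolution ν 0 u p T → IsLerayHopfOn T ν 0 (u 0) u → HasRapidSpatialDecay (u 0) → IsAxisymmetric (u 0) → (∀ x₀ : EuclideanSpace ℝ (Fin 3), Filter.Tendsto (fun r : ℝ => r⁻¹ * ∫ x in Metric.ball x₀ r, ‖u T x‖ ^ 2) (nhdsWithin 0 (Set.Ioi 0)) (nhds 0)) → (∀ K : ℝ, ∃ t ∈ Set.Ioo 0 T, ∃ x, normalisedPressure (u t) x < -K) ∧ (∀ K : ℝ, ∃ t ∈ Set.Ioo 0 T, ∃ x, K < ‖u t x‖ ^ 2 / 2 + normalisedPressure (u t) x) := by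
  intro ν T u p hν hT hmax hLH hdec _haxi hFE
  refine ⟨fun K => ?_, fun K => ?_⟩
  · -- pressure floor `-K ≤ p̃` on `(0, T) × ℝ³` would continue `u` past `T`
    by_contra h
    push Not at h
    exact hmax.2 (seregin_sverak_2002_withFinalEnergy.hasSmoothExtensionPast hν hT hmax.1 hLH hdec
      (Or.inr ⟨K, h⟩) hFE)
  · -- head ceiling `‖u‖²/2 + p̃ ≤ K` on `(0, T) × ℝ³` would continue `u` past `T`
    by_contra h
    push Not at h
    exact hmax.2 (seregin_sverak_2002_withFinalEnergy.hasSmoothExtensionPast hν hT hmax.1 hLH hdec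
      (Or.inl ⟨K, h⟩) hFE)

end Summit.NavierStokesRegularity.NavierStokesRegularity.Theorems.CertifiedBlowupAxisymBlowup.CompactAmplification

end
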